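import Summits.CriticalPhenomena.PercolationContinuityZ3.Theorems.PercNearOneGluingNoHeavyLowerTailSwitchRelaxCheck
import Mathlib.Algebra.Order.BigOperators.Group.List
import HarnessLib

/-!
# `NoHeavyLowerTail` (stmt-CriticalPhenomena-4575) — FOUR-copy switching certificates, III-a: packed vectors of naturals
# (positional base-`2^32` digits) and their arithmetic, as read by the kernel with GMP operations

Support file (prover prim-ineq-prove-3 gen 8; `--supports stmt-CriticalPhenomena-4575`).  No named facts, no sorries.

The four-copy certificate checker (`…FourCopyHubCheck`) stores, for every program, the table "option `p` of the side copy ↦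
best potential value" as ONE natural number `Σ_p (value_p + OFF)·2^{32 p}` (`pvec`), so that adding the tables of the
programs of a fibre is a single addition and reading an entry is a shift (`digW`).  This file is the arithmetic of that
encoding: `packL`/`dig` (positional digits, `dig_packL`), sums of packed lists (`packL_add`, `sum_map_pvecN`), the digit
bound after summing (`dig_sum_pvecN`), rows of vectors in base `2^480` (`digV`, `pvecN_lt_HEAD`), the shift forms, the
offset encoding `enc` of integers (`add_OFF_le_enc`, `enc_lt`), and list maxima `lmax`/`nmax`.
-/

namespace Summit.CriticalPhenomena.PercolationContinuityZ3.Theorems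

namespace FourCopyHub

open SwitchRelax

/-! ### Positional digits -/

/-- Digit base of packed vectors. [this work] -/
def BW : ℕ := 4294967296
/-- `BW = 2^32`. [this work] -/
theorem BW_eq : BW = 2 ^ 32 := by decide
/-- Base of packed rows of vectors (`BW ^ 15 = 2^480`, written out). [this work] -/
def BV : ℕ :=
  3121748550315992231381597229793166305748598142664971150859156959625371738819765620120306103063491971159826931121406622895447975679288285306290176
/-- `BV = 2^480` (kernel computation). [this work] -/
theorem two_pow_480 : (2 : ℕ) ^ 480 = BV := by decide +kernel
/-- `BV` is positive. [this work] -/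
theorem BV_pos : 0 < BV := by decide
/-- Offset added to every stored value. [this work] -/
def OFF : ℤ := 1048576
/-- `OFF = 2^20`. [this work] -/
theorem OFF_eq : OFF = 2 ^ 20 := by decide
/-- Bound on stored digits: `2 · OFF`. [this work] -/
def DMAX : ℕ := 2097152
/-- `DMAX = 2^21`. [this work] -/
theorem DMAX_eq : DMAX = 2 ^ 21 := by decide

/-- Pack a digit list: `d₀ + b·(d₁ + b·(d₂ + …))`. [folklore] -/
def packL (b : ℕ) : List ℕ → ℕ
  | [] => 0
  | d :: ds => d + b * packL b ds

/-- Digit `i` in base `b`. [folklore] -/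
def dig (b N i : ℕ) : ℕ := N / b ^ i % b

/-- **Digits of a packed list** (no carries when all digits are `< b`). [folklore] -/
theorem dig_packL {b : ℕ} (hb : 0 < b) : ∀ (L : List ℕ), (∀ d ∈ L, d < b) → ∀ i, dig b (packL b L) i = L.getD i 0
  | [], _, i => by simp [dig, packL]
  | d :: ds, h, i => by
    have hd : d < b := h d List.mem_cons_self
    have hds : ∀ x ∈ ds, x < b := fun x hx => h x (List.mem_cons_of_mem _ hx)
    cases i with
    | zero => simp [dig, packL, Nat.add_mul_mod_self_left, Nat.mod_eq_of_lt hd]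
    | succ i =>
      have key : (d + b * packL b ds) / b ^ (i + 1) = packL b ds / b ^ i := by
        rw [pow_succ', ← Nat.div_div_eq_div_mul, Nat.add_mul_div_left _ _ hb, Nat.div_eq_of_lt hd, zero_add]
      have ih := dig_packL hb ds hds i
      simp only [dig] at ih ⊢
      rw [packL, key, ih]
      simp

/-- Packing is additive on lists of equal length. [folklore] -/
theorem packL_add (b : ℕ) : ∀ (L M : List ℕ), L.length = M.length →
    packL b L + packL b M = packL b (List.zipWith (· + ·) L M)
  | [], [], _ => by simp [packL]
  | [], _ :: _, h => by simp at h
  | _ :: _, [], h => by simp at h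
  | d :: ds, e :: es, h => by
    simp only [List.length_cons, add_left_inj] at h
    simp only [packL, List.zipWith_cons_cons]
    rw [← packL_add b ds es h]; ring

/-- A packed list with digits `≤ m` is at most `m · Σ_{i<len} bⁱ`. [folklore] -/
theorem packL_le {b m : ℕ} : ∀ (L : List ℕ), (∀ d ∈ L, d ≤ m) →
    packL b L ≤ m * ((List.range L.length).map fun i => b ^ i).sum
  | [], _ => by simp [packL]
  | d :: ds, h => by
    have hd : d ≤ m := h d List.mem_cons_self
    have ih := packL_le (b := b) (m := m) ds fun x hx => h x (List.mem_cons_of_mem _ hx)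
    rw [packL, List.length_cons, List.range_succ_eq_map, List.map_cons, List.sum_cons, pow_zero, List.map_map]
    have e : ((List.range ds.length).map ((fun i => b ^ i) ∘ Nat.succ)).sum =
        b * ((List.range ds.length).map fun i => b ^ i).sum := by
      rw [← List.sum_map_mul_left]; congr 1; apply List.map_congr_left; intro i _; simp [pow_succ]; ring
    rw [e]
    nlinarith

/-- Packing zeros gives zero. [folklore] -/
theorem packL_map_zero (b : ℕ) : packL b (allTys.map fun _ => 0) = 0 := by simp [allTys, packL]

/-- `zipWith (+)` of two maps of one list. [folklore] -/
theorem zipWith_add_map_map {α : Type} (l : List α) (g h : α → ℕ) :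
    List.zipWith (· + ·) (l.map g) (l.map h) = l.map fun a => g a + h a := by
  induction l with
  | nil => rfl
  | cons a l ih => simp [ih]

/-! ### Packed vectors over the fifteen types -/

/-- The packed vector of a natural-valued table on types. [this work] -/
def pvecN (g : Ty → ℕ) : ℕ := packL BW (allTys.map g)

/-- `allTys` lists the types in order. [folklore] -/
theorem getElem?_allTys (p : Ty) : allTys[p.val]? = some p := by fin_cases p <;> rfl

/-- Length of `allTys`. [folklore] -/
theorem length_allTys : allTys.length = 15 := rfl

/-- Reading a mapped `allTys` at `p.val`. [folklore] -/
theorem getD_map_allTys {α : Type} (g : Ty → α) (p : Ty) (d : α) : (allTys.map g).getD p.val d = g p := by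
  rw [List.getD_eq_getElem?_getD, List.getElem?_map, getElem?_allTys]; rfl

/-- **Digits of a packed vector**: `dig BW (pvecN g) p = g p` when all entries are `< BW`. [this work] -/
theorem dig_pvecN {g : Ty → ℕ} (hg : ∀ q, g q < BW) (p : Ty) : dig BW (pvecN g) p.val = g p := by
  unfold pvecN
  rw [dig_packL (by decide) _ (fun d hd => ?_), getD_map_allTys]
  obtain ⟨q, _, rfl⟩ := List.mem_map.1 hd
  exact hg q

/-- Packed vectors add entrywise. [this work] -/
theorem pvecN_add (g h : Ty → ℕ) : pvecN g + pvecN h = pvecN (fun p => g p + h p) := by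
  unfold pvecN
  rw [packL_add _ _ _ (by simp), zipWith_add_map_map]

/-- A sum of packed vectors is the packed vector of the entrywise sum. [this work] -/
theorem sum_map_pvecN {ι : Type} (L : List ι) (g : ι → Ty → ℕ) :
    (L.map fun k => pvecN (g k)).sum = pvecN (fun p => (L.map fun k => g k p).sum) := by
  induction L with
  | nil => exact (packL_map_zero BW).symm
  | cons a L ih => simp only [List.map_cons, List.sum_cons, ih, pvecN_add]

/-- Entrywise bound ⇒ digit readable after summing: if every table has entries `< DMAX` and there are fewer than `2048`
of them, the digits of the summed packed vector are the sums of the entries. [this work] -/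
theorem dig_sum_pvecN {ι : Type} (L : List ι) (g : ι → Ty → ℕ) (hg : ∀ k ∈ L, ∀ q, g k q < DMAX)
    (hL : L.length < 2048) (p : Ty) :
    dig BW (L.map fun k => pvecN (g k)).sum p.val = (L.map fun k => g k p).sum := by
  rw [sum_map_pvecN]
  refine dig_pvecN (fun q => ?_) p
  calc (L.map fun k => g k q).sum ≤ (L.map fun _ => DMAX).sum :=
        List.sum_le_sum fun k hk => (hg k hk q).le
    _ = L.length * DMAX := by simp
    _ < 2048 * DMAX := by
        exact Nat.mul_lt_mul_of_lt_of_le hL le_rfl (by decide)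
    _ = BW := by decide

/-- Packed vectors with entries `< DMAX` are `< HEAD = 2^470` (written out; headroom for summing rows). [this work] -/
def HEAD : ℕ :=
  3048582568667961163458591044719888970457615373696260889510895468384152088691177363398736428772941378085768487423248655171335913749304966119424

/-- The geometric sum `Σ_{i<15} BWⁱ`. [this work] -/
theorem geom15 : ((List.range 15).map fun i => BW ^ i).sum * DMAX ≤ HEAD := by decide +kernel

/-- A packed vector with small entries is small. [this work] -/
theorem pvecN_lt_HEAD {g : Ty → ℕ} (hg : ∀ q, g q < DMAX) : pvecN g < HEAD := by
  have h := packL_le (b := BW) (m := DMAX - 1) (allTys.map g) (fun d hd => by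
    obtain ⟨q, _, rfl⟩ := List.mem_map.1 hd; exact Nat.le_sub_one_of_lt (hg q))
  rw [List.length_map, length_allTys] at h
  unfold pvecN
  calc packL BW (allTys.map g) ≤ (DMAX - 1) * ((List.range 15).map fun i => BW ^ i).sum := h
    _ < DMAX * ((List.range 15).map fun i => BW ^ i).sum :=
        Nat.mul_lt_mul_of_lt_of_le (by decide) le_rfl (by decide +kernel)
    _ ≤ HEAD := by rw [mul_comm]; exact geom15

/-! ### Rows of packed vectors (base `BV`) -/

/-- Sum of fewer than `1024` vectors below `HEAD` stays below `BV`. [this work] -/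
theorem sum_lt_BV {L : List ℕ} (h : ∀ x ∈ L, x < HEAD) (hL : L.length < 1024) : L.sum < BV := by
  calc L.sum ≤ (L.map fun _ => HEAD).sum := by
        have : L.sum = (L.map id).sum := by simp
        rw [this]; exact List.sum_le_sum fun x hx => (h x hx).le
    _ = L.length * HEAD := by simp
    _ < 1024 * HEAD := Nat.mul_lt_mul_of_lt_of_le hL le_rfl (by decide +kernel)
    _ = BV := by decide +kernel

/-- **Digits of a sum of packed rows**: if the rows `R k = packL BV (allTys.map (v k))` have blocks `< HEAD` and there are
fewer than `1024` of them, block `t` of the sum is the sum of the blocks. [this work] -/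
theorem dig_sum_rows {ι : Type} (L : List ι) (v : ι → Ty → ℕ) (hv : ∀ k ∈ L, ∀ q, v k q < HEAD)
    (hL : L.length < 1024) (t : Ty) :
    dig BV (L.map fun k => packL BV (allTys.map (v k))).sum t.val = (L.map fun k => v k t).sum := by
  have hsum : (L.map fun k => packL BV (allTys.map (v k))).sum =
      packL BV (allTys.map fun q => (L.map fun k => v k q).sum) := by
    clear hL
    induction L with
    | nil => exact (packL_map_zero BV).symm
    | cons a L ih =>
      simp only [List.map_cons, List.sum_cons]
      rw [ih (fun k hk => hv k (List.mem_cons_of_mem _ hk)), packL_add _ _ _ (by simp), zipWith_add_map_map]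
  rw [hsum, dig_packL BV_pos _ (fun d hd => ?_), getD_map_allTys]
  obtain ⟨q, _, rfl⟩ := List.mem_map.1 hd
  exact sum_lt_BV (fun x hx => by obtain ⟨k, hk, rfl⟩ := List.mem_map.1 hx; exact hv k hk q) (by simpa using hL)

/-! ### Shift forms (what the kernel evaluates) -/

/-- Digit `i` in base `BW` by shifting. [this work] -/
def digW (N i : ℕ) : ℕ := (N >>> (32 * i)) % 4294967296
/-- Block `i` in base `BV` by shifting. [this work] -/
def digV (N i : ℕ) : ℕ := (N >>> (480 * i)) % BV

/-- `digW` is `dig BW`. [this work] -/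
theorem digW_eq (N i : ℕ) : digW N i = dig BW N i := by
  rw [digW, dig, Nat.shiftRight_eq_div_pow, BW_eq, ← pow_mul]; rfl

/-- `digV` is `dig BV`. [this work] -/
theorem digV_eq (N i : ℕ) : digV N i = dig BV N i := by
  rw [digV, dig, Nat.shiftRight_eq_div_pow, pow_mul, two_pow_480]

/-! ### The offset encoding of integers and list maxima -/

/-- Encode an integer as a stored natural (`+ OFF`, negative part cut to `0`). [this work] -/
def enc (z : ℤ) : ℕ := (z + OFF).toNat

/-- A value below `f` is, after the offset, below the stored natural. [this work] -/
theorem add_OFF_le_enc {v f : ℤ} (h : v ≤ f) : v + OFF ≤ (enc f : ℤ) := by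
  unfold enc; have := Int.self_le_toNat (f + OFF); omega

/-- Stored naturals of values below `OFF` are below `DMAX`. [this work] -/
theorem enc_lt {f : ℤ} (h : f < OFF) : enc f < DMAX := by
  unfold enc
  have h2 : f + OFF < (DMAX : ℤ) := by rw [OFF_eq] at h ⊢; rw [DMAX_eq]; push_cast; omega
  by_cases hn : 0 ≤ f + OFF
  · exact_mod_cast (show ((f + OFF).toNat : ℤ) < DMAX by rwa [Int.toNat_of_nonneg hn])
  · rw [Int.toNat_eq_zero.2 (by omega)]; decide

/-- `max` of a list of integers (`bot` if empty). [folklore] -/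
def lmax (L : List ℤ) : ℤ := L.foldr max bot
/-- Members are bounded by `lmax`. [folklore] -/
theorem le_lmax {x : ℤ} {L : List ℤ} (h : x ∈ L) : x ≤ lmax L := le_foldr_max bot h
/-- `lmax` is below any strict upper bound `≥ bot` of the members. [folklore] -/
theorem lmax_lt {L : List ℤ} {B : ℤ} (hB : bot < B) (h : ∀ x ∈ L, x < B) : lmax L < B := by
  induction L with
  | nil => exact hB
  | cons a L ih =>
    simp only [lmax, List.foldr_cons, max_lt_iff]
    exact ⟨h a List.mem_cons_self, ih fun x hx => h x (List.mem_cons_of_mem _ hx)⟩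

/-- `max` of a list of naturals (`0` if empty). [folklore] -/
def nmax (L : List ℕ) : ℕ := L.foldr max 0
/-- Members are bounded by `nmax`. [folklore] -/
theorem le_nmax {x : ℕ} : ∀ {L : List ℕ}, x ∈ L → x ≤ nmax L
  | [], h => absurd h List.not_mem_nil
  | y :: L, h => by
    simp only [nmax, List.foldr_cons]
    rcases List.mem_cons.1 h with rfl | h
    · exact le_max_left _ _
    · exact le_trans (le_nmax h) (le_max_right _ _)

/-- Positional lookup with default. [folklore] -/
def lk {α : Type} (L : List α) (i : ℕ) (d : α) : α := (L[i]?).getD d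

/-- Lookup in a mapped `allTys`. [folklore] -/
theorem lk_map_allTys {α : Type} (g : Ty → α) (p : Ty) (d : α) : lk (allTys.map g) p.val d = g p := by
  rw [lk, List.getElem?_map, getElem?_allTys]; rfl

/-- Lookup in a mapped `List.finRange 4`. [folklore] -/
theorem lk_map_finRange4 {α : Type} (g : Fin 4 → α) (u : Fin 4) (d : α) : lk ((List.finRange 4).map g) u.val d = g u := by
  fin_cases u <;> rfl

end FourCopyHub

end Summit.CriticalPhenomena.PercolationContinuityZ3.Theorems
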